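import Summits.FinalStateConjecture.FinalStateConjecture.Theses.BondiDrainDispersal
import Summits.FinalStateConjecture.FinalStateConjecture.Theorems.BondiDrainDispersalHorizonlessMustDrainLogicTier
import Literature.Geometry.Lorentzian.CompleteDevelopmentMaximal
import Literature.Geometry.Lorentzian.GeodesicIncompleteness
import HarnessLib

/-!
# Crux `HorizonlessMustDrain` (stmt-FinalStateConjecture-9976) — the incomplete sector on fibres with a complete development

Helper file of the crux `Theses.BondiDrainDispersal.HorizonlessMustDrain` (`--supports stmt-FinalStateConjecture-9976`;
lead c5, stub-worker of `stub_incompleteSector`, 2026-08-17).  The registered skeleton of line `registered`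
(= `Cruxes/HorizonlessMustDrain/Lines/birth.lean`) is the equivalence `crux ↔ completeSector ∧ incompleteSector`
(`horizonlessMustDrain_iff_sectors`, LogicTier): the INCOMPLETE SECTOR says that every maximal vacuum Cauchy
development of an admissible datum with complete `𝓘⁺` (sojourn form), no event horizon (typed clause) and which is NOT
future causally geodesically complete has vanishing final Bondi mass.  Over the tree it is neither provable (no MGHD
future-boundary theory: the sufficient censorship fact (★) "visible incompleteness is naked" is unprinted,
`…HiddenOfNaked.lean`) nor refutable (no MGHD other than isometric copies of Minkowski space is constructible).

This file certifies its FIBREWISE form, which is provable now: **if the datum `D` has ONE geodesically complete vacuum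
Cauchy development `𝒟c`, then every maximal vacuum Cauchy development `𝒟` of `D` is geodesically complete**
(`isGeodesicallyComplete_of_isMaximal_of_completeDevelopment`: `𝒟c` embeds into `𝒟` by maximality, the embedding is
onto because `𝒟c` is complete — O'Neill 1983, Ch. 7, Cor. 7.29, `DataEmbedding.surjective_of_isGeodesicallyComplete` —
and a surjective isometric immersion with complete source has complete target,
`IsIsometricImmersion.isGeodesicallyComplete_of_surjective`), **hence future causally geodesically complete**
(`futureCausallyComplete_of_isMaximal_of_completeDevelopment`: no future-incomplete future-directed null or timelike
maximal geodesic, Hawking–Ellis 1973, §8.1, via `not_isFutureNullGeodesicallyIncomplete_of_isGeodesicallyComplete` of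
LogicTier and its timelike twin proved here), **so the incomplete-sector instance at `𝒟` holds vacuously**
(`incompleteSectorInstance_of_completeDevelopment`, pointwise in `(D, 𝒟c, 𝒟)` like `cruxInstance_of_completeDevelopment`;
and the glue stub `stub_incompleteSectorFibre`, the registered stub's exact binder shape with the one
extra hypothesis `∃ 𝒟c, complete` inserted after `D ∈ admissibleVacuumData X`).  In particular the incomplete sector holds on
the trivial-datum fibre (Minkowski space is geodesically complete) and on the fibre of every datum whose stability
theorem is ported in the geodesically-complete existence form.

Everything is proved; no definition and no named fact is introduced.

## References
* B. O'Neill, *Semi-Riemannian geometry with applications to relativity*, Academic Press 1983, Ch. 7, Thm. 7.28,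
  Cor. 7.29. Key `ONeillSemiRiemannian1983`.
* Y. Choquet-Bruhat, R. Geroch, Comm. Math. Phys. 14 (1969) 329–335, Thm. 3. Key `ChoquetBruhatGeroch1969CMP`.
* S. W. Hawking, G. F. R. Ellis, *The large scale structure of space-time*, CUP 1973, §8.1. Key `HawkingEllis1973`.
-/

set_option linter.dupNamespace false

noncomputable section

open scoped Manifold ContDiff Topology
open Set Function Literature.Geometry.Lorentzian

namespace Summit.FinalStateConjecture.FinalStateConjecture.Theorems.BondiDrainDispersalHorizonlessMustDrain

/-! ### Geodesic completeness of a Cauchy development excludes future timelike incompleteness -/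

/-- A geodesically complete Cauchy development is not future timelike geodesically incomplete (the timelike twin of
`not_isFutureNullGeodesicallyIncomplete_of_isGeodesicallyComplete`): the Levi-Civita connection of a spacetime is `C¹`
(`isLocallyContMDiff_leviCivita_holds`), so a future-incomplete maximal timelike geodesic would contradict timelike
geodesic completeness (`not_isTimelikeGeodesicallyComplete_of_isFutureTimelikeGeodesicallyIncomplete_holds`).
Hawking–Ellis 1973, §8.1. [cite: HawkingEllis1973, §8.1] -/
theorem not_isFutureTimelikeGeodesicallyIncomplete_of_isGeodesicallyComplete
    {X : Type} [TopologicalSpace X] [ChartedSpace E3 X] [IsManifold (𝓡 3) ∞ X] [ConnectedSpace X]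
    {D : InitialDataSet (𝓡 3) X} (𝒟 : CauchyDevelopment D)
    (hc : ∀ [𝒟.metric.toPseudoRiemannianMetric.HasLeviCivita],
      IsGeodesicallyComplete 𝒟.metric.toPseudoRiemannianMetric.leviCivita) :
    ∀ [𝒟.metric.HasLeviCivita], ¬ 𝒟.metric.IsFutureTimelikeGeodesicallyIncomplete 𝒟.timeOrientation := by
  intro _ hinc
  haveI : CovariantDerivative.ContMDiffCovariantDerivative 𝒟.metric.toPseudoRiemannianMetric.leviCivita 1 :=
    ⟨𝒟.metric.isLocallyContMDiff_leviCivita_holds 1 (by exact_mod_cast le_top) univ isOpen_univ⟩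
  exact LorentzianMetric.not_isTimelikeGeodesicallyComplete_of_isFutureTimelikeGeodesicallyIncomplete_holds
    𝒟.timeOrientation hinc
    (𝒟.metric.isCausalGeodesicallyComplete_iff.1
      (𝒟.metric.isCausalGeodesicallyComplete_of_isGeodesicallyComplete hc)).1

/-! ### One geodesically complete development makes every maximal development complete -/

/-- **Every maximal vacuum Cauchy development of a datum with a geodesically complete vacuum Cauchy development is
geodesically complete.**  The complete development `𝒟c` embeds into the maximal `𝒟` (maximality); the embedding `ψ` is
an isometric immersion with geodesically complete source into a connected spacetime of the same dimension, hence onto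
(O'Neill 1983, Ch. 7, Thm. 7.28 and Cor. 7.29: `DataEmbedding.surjective_of_isGeodesicallyComplete`), and the target of a
surjective isometric immersion with complete source is complete (`φ ∘ γ_v` extends every geodesic over `ℝ`, ibid.,
proof of Cor. 7.29: `IsIsometricImmersion.isGeodesicallyComplete_of_surjective`).  Choquet-Bruhat–Geroch 1969, Thm. 3
(the complete solution is the maximal development). [cite: ONeillSemiRiemannian1983, Ch. 7, Cor. 7.29] -/
theorem isGeodesicallyComplete_of_isMaximal_of_completeDevelopment
    {X : Type} [TopologicalSpace X] [ChartedSpace E3 X] [IsManifold (𝓡 3) ∞ X] [ConnectedSpace X]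
    {D : InitialDataSet (𝓡 3) X} (𝒟c 𝒟 : VacuumCauchyDevelopment D)
    (hc : ∀ [𝒟c.metric.toPseudoRiemannianMetric.HasLeviCivita],
      IsGeodesicallyComplete 𝒟c.metric.toPseudoRiemannianMetric.leviCivita)
    (hmax : 𝒟.IsMaximal) :
    ∀ [𝒟.metric.toPseudoRiemannianMetric.HasLeviCivita],
      IsGeodesicallyComplete 𝒟.metric.toPseudoRiemannianMetric.leviCivita := by
  intro _
  haveI := 𝒟c.metric.toPseudoRiemannianMetric.hasLeviCivita
  obtain ⟨ψ, -, -, hψi, -, -⟩ := hmax 𝒟c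
  exact hψi.isGeodesicallyComplete_of_surjective rfl hc
    (DataEmbedding.surjective_of_isGeodesicallyComplete hψi hc)

/-- **Every maximal vacuum Cauchy development of a datum with a geodesically complete vacuum Cauchy development is
future causally geodesically complete**: no maximal future-directed null or timelike geodesic of `𝒟` has affine domain
bounded above (`isGeodesicallyComplete_of_isMaximal_of_completeDevelopment`, then Hawking–Ellis 1973, §8.1:
`not_isFutureNullGeodesicallyIncomplete_of_isGeodesicallyComplete` and its timelike twin).
[cite: HawkingEllis1973, §8.1] -/
theorem futureCausallyComplete_of_isMaximal_of_completeDevelopment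
    {X : Type} [TopologicalSpace X] [ChartedSpace E3 X] [IsManifold (𝓡 3) ∞ X] [ConnectedSpace X]
    {D : InitialDataSet (𝓡 3) X} (𝒟c 𝒟 : VacuumCauchyDevelopment D)
    (hc : ∀ [𝒟c.metric.toPseudoRiemannianMetric.HasLeviCivita],
      IsGeodesicallyComplete 𝒟c.metric.toPseudoRiemannianMetric.leviCivita)
    (hmax : 𝒟.IsMaximal) :
    ∀ [𝒟.metric.HasLeviCivita], ¬ 𝒟.metric.IsFutureNullGeodesicallyIncomplete 𝒟.timeOrientation ∧
      ¬ 𝒟.metric.IsFutureTimelikeGeodesicallyIncomplete 𝒟.timeOrientation := by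
  have h : ∀ [𝒟.metric.toPseudoRiemannianMetric.HasLeviCivita],
      IsGeodesicallyComplete 𝒟.metric.toPseudoRiemannianMetric.leviCivita :=
    @isGeodesicallyComplete_of_isMaximal_of_completeDevelopment X _ _ _ _ D 𝒟c 𝒟 hc hmax
  intro _
  exact ⟨not_isFutureNullGeodesicallyIncomplete_of_isGeodesicallyComplete 𝒟.toCauchyDevelopment h,
    not_isFutureTimelikeGeodesicallyIncomplete_of_isGeodesicallyComplete 𝒟.toCauchyDevelopment h⟩

/-! ### The incomplete sector of the crux holds, vacuously, on every fibre with a complete development -/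

/-- **THE INCOMPLETE-SECTOR INSTANCE AT EVERY MGHD FROM ONE COMPLETE DEVELOPMENT** (pointwise in `(D, 𝒟c, 𝒟)`, the
companion of `cruxInstance_of_completeDevelopment`; admissibility of `D` is not needed): if some vacuum Cauchy
development `𝒟c` of `D` is geodesically complete, then for every maximal vacuum Cauchy development `𝒟` of `D` the
incomplete sector of `HorizonlessMustDrain` — complete `𝓘⁺` (sojourn form) + no event horizon (typed clause) + NOT
future causally geodesically complete ⇒ vanishing final Bondi mass — holds VACUOUSLY: `𝒟` is future causally
geodesically complete (`futureCausallyComplete_of_isMaximal_of_completeDevelopment`), so its incompleteness hypothesis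
is absurd.  Choquet-Bruhat–Geroch 1969, Thm. 3; O'Neill 1983, Ch. 7, Cor. 7.29. [cite: ChoquetBruhatGeroch1969CMP, Thm. 3] -/
theorem incompleteSectorInstance_of_completeDevelopment
    {X : Type} [TopologicalSpace X] [ChartedSpace E3 X] [IsManifold (𝓡 3) ∞ X] [ConnectedSpace X]
    {D : InitialDataSet (𝓡 3) X} (𝒟c 𝒟 : VacuumCauchyDevelopment D)
    (hc : ∀ [𝒟c.metric.toPseudoRiemannianMetric.HasLeviCivita],
      IsGeodesicallyComplete 𝒟c.metric.toPseudoRiemannianMetric.leviCivita)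
    (hmax : 𝒟.IsMaximal) :
    Summit.FinalStateConjecture.HasCompleteNullInfinity 𝒟.toCauchyDevelopment →
      ¬ (∀ [𝒟.metric.HasLeviCivita], ∃ q : 𝒟.carrier, ∀ (p : X) (γ : ℝ → 𝒟.carrier) (dom : Set ℝ),
          𝒟.metric.IsNormalisedNullRayFrom 𝒟.timeOrientation 𝒟.embed 𝒟.normal p γ dom → ¬ BddAbove dom →
            q ∉ 𝒟.metric.chronologicalPast 𝒟.timeOrientation (γ '' (dom ∩ Set.Ici 0))) →
      ¬ (∀ [𝒟.metric.HasLeviCivita], ¬ 𝒟.metric.IsFutureNullGeodesicallyIncomplete 𝒟.timeOrientation ∧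
          ¬ 𝒟.metric.IsFutureTimelikeGeodesicallyIncomplete 𝒟.timeOrientation) →
      𝒟.toCauchyDevelopment.HasVanishingFinalBondiMass :=
  fun _ _ hinc ↦ (hinc (futureCausallyComplete_of_isMaximal_of_completeDevelopment 𝒟c 𝒟 hc hmax)).elim

/-- **Glue stub `stub_incompleteSectorFibre` — THE INCOMPLETE SECTOR ON FIBRES WITH A COMPLETE DEVELOPMENT**: the
registered stub `stub_incompleteSector` of line `registered`, verbatim in its binder shape, with the single extra hypothesis "`D` has a geodesically complete vacuum
Cauchy development" inserted after `D ∈ admissibleVacuumData X`: on every such fibre the incomplete sector of the crux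
holds (vacuously, `incompleteSectorInstance_of_completeDevelopment`).  This is the exact interface by which a model or
stability-theorem spacetime, ported in the geodesically-complete existence form, certifies the incomplete sector on its
datum; the trivial datum `(ℝ³, δ, 0)` (Minkowski space, `minkowski_isGeodesicallyComplete_holds`) is the first instance.
Choquet-Bruhat–Geroch 1969, Thm. 3; Hawking–Ellis 1973, §8.1. [cite: ChoquetBruhatGeroch1969CMP, Thm. 3] -/
theorem stub_incompleteSectorFibre : open scoped Manifold in ∀ (X : Type) [TopologicalSpace X] [ChartedSpace Literature.Geometry.Lorentzian.E3 X] [IsManifold (𝓡 3) ((⊤ : ℕ∞) : WithTop ℕ∞) X] [T2Space X] [SecondCountableTopology X] [ConnectedSpace X], ∀ D ∈ Literature.Geometry.Lorentzian.admissibleVacuumData X, (∃ 𝒟c : Literature.Geometry.Lorentzian.VacuumCauchyDevelopment D, ∀ [𝒟c.metric.toPseudoRiemannianMetric.HasLeviCivita], Literature.Geometry.Lorentzian.IsGeodesicallyComplete 𝒟c.metric.toPseudoRiemannianMetric.leviCivita) → ∀ 𝒟 : Literature.Geometry.Lorentzian.VacuumCauchyDevelopment D, 𝒟.IsMaximal →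 Summit.FinalStateConjecture.HasCompleteNullInfinity 𝒟.toCauchyDevelopment → ¬ (∀ [𝒟.metric.HasLeviCivita], ∃ q : 𝒟.carrier, ∀ (p : X) (γ : ℝ → 𝒟.carrier) (dom : Set ℝ), 𝒟.metric.IsNormalisedNullRayFrom 𝒟.timeOrientation 𝒟.embed 𝒟.normal p γ dom → ¬ BddAbove dom → q ∉ 𝒟.metric.chronologicalPast 𝒟.timeOrientation (γ '' (dom ∩ Set.Ici 0))) → ¬ (∀ [𝒟.metric.HasLeviCivita], ¬ 𝒟.metric.IsFutureNullGeodesicallyIncomplete 𝒟.timeOrientation ∧ ¬ 𝒟.metric.IsFutureTimelikeGeodesicallyIncomplete 𝒟.timeOrientation) → 𝒟.toCauchyDevelopment.HasVanishingFinalBondiMass := by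
  intro X _ _ _ _ _ _ D _ hex 𝒟 hmax hscri hH hinc
  obtain ⟨𝒟c, hc⟩ := hex
  exact incompleteSectorInstance_of_completeDevelopment 𝒟c 𝒟 hc hmax hscri hH hinc

/-- **The incomplete sector holds on the whole fibre over the trivial datum** (every maximal vacuum Cauchy development of
`(ℝ³, δ, 0)`; Minkowski space is a geodesically complete vacuum Cauchy development of it, O'Neill 1983, Ch. 3,
Ex. 3.25, `minkowski_isGeodesicallyComplete_holds`). [cite: ONeillSemiRiemannian1983, Ch. 3, Ex. 3.25] -/
theorem incompleteSector_trivialDatumFibre :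
    ∀ 𝒟 : VacuumCauchyDevelopment trivialData, 𝒟.IsMaximal →
      Summit.FinalStateConjecture.HasCompleteNullInfinity 𝒟.toCauchyDevelopment →
      ¬ (∀ [𝒟.metric.HasLeviCivita], ∃ q : 𝒟.carrier, ∀ (p : Minkowski.slice) (γ : ℝ → 𝒟.carrier) (dom : Set ℝ),
          𝒟.metric.IsNormalisedNullRayFrom 𝒟.timeOrientation 𝒟.embed 𝒟.normal p γ dom → ¬ BddAbove dom →
            q ∉ 𝒟.metric.chronologicalPast 𝒟.timeOrientation (γ '' (dom ∩ Set.Ici 0))) →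
      ¬ (∀ [𝒟.metric.HasLeviCivita], ¬ 𝒟.metric.IsFutureNullGeodesicallyIncomplete 𝒟.timeOrientation ∧
          ¬ 𝒟.metric.IsFutureTimelikeGeodesicallyIncomplete 𝒟.timeOrientation) →
      𝒟.toCauchyDevelopment.HasVanishingFinalBondiMass :=
  fun 𝒟 hmax ↦ incompleteSectorInstance_of_completeDevelopment Minkowski.vacuumCauchyDevelopment 𝒟
    @minkowski_isGeodesicallyComplete_holds hmax

end Summit.FinalStateConjecture.FinalStateConjecture.Theorems.BondiDrainDispersalHorizonlessMustDrain

end
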